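import Summits.Langlands.Langlands.Statement
import Literature.NumberTheory.Automorphic.DieulefaitBaseChangeGL2
import HarnessLib

/-!
# F3 WITNESS for the rung `RealQuadraticBaseChangeGL2 = NonsolvableBaseChangeGL2 2` of line `RealQuadraticBaseChangeGL2`
# (crux `ReciprocityUpToIrreducibility`, item stmt-Langlands-14328; forward generator G4 ladder-down, generation 16)

The graded family `NonsolvableBaseChangeGL2 d₀` (dial θ19 = degree `d₀ = [F₀:ℚ]` of the totally real BOTTOM field in
non-solvable base change for `GL₂`, clause (B) of the summit over the top field applied to `ρ₀|Γ_F`) SPECIALISES at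
`d₀ = 1` to the PROVED floor: Dieulefait, JMPA 104 (2015) Thm. 1.2 = arXiv:1208.3946 p. 5 ("Let `f` be a newform of
arbitrary level and weight. Let `F` be any totally real number field. Then, `f` can be lifted to `F`"), §5 p. 19
("without local conditions on the totally real number field `F`. We do not even assume that `F` is a Galois number
field"); earlier Annals 176 (2012) Thm. 1.1 (arXiv:0912.2080 p. 3) under splitting conditions at `2, 3, 5, 7, 11`.
In the tree: the named fact `Literature.NumberTheory.Automorphic.Dieulefait2015_baseChange_GL2` (vendored by this unit,
proposal p188171, commit 52ad03e5f4d1), stated over "number fields `F₀` with `Module.finrank ℚ F₀ = 1`" (= `F₀ ≅ ℚ`) in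
exactly the family's binder shape, so that `floor_one` is three lines: the family at `d₀ = 1` carries three EXTRA
hypotheses on `ρ₀|Γ_F` (irreducible, a.e. unramified, de Rham above `ℓ`) that the floor does not need.

WITNESS REGIME (F9): the floor (bottom field `ℚ`, top field ANY totally real `F`, insoluble `F/ℚ` allowed) lies OUTSIDE
the regime where the summit is known — clause (B) for `GL₂` over a general totally real `F` is open (Fontaine–Mazur
over totally real fields: residual-image and `p`-local hypotheses remain in every printed MLT; even automorphy of all
elliptic curves over all totally real fields is open beyond degree `3`, cf. g6) — and it EXERCISES the line's lever
(propagation of automorphy along safe chains of congruences, each link an MLT over the TOP field, never base change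
along `F/F₀`): `S` known there: no.

THE RUNG `d₀ = 2` (real quadratic bottom fields) is OPEN in print: "For general extensions of number fields `L/F` the
problem remains open … Dieulefait [Die15] solved the base-change problem for `GL₂` with `F = ℚ` and `L` totally real"
[corpus:paper:arxiv-2604.05618 p. 3]; Dieulefait–Pacetti [corpus:paper:arxiv-1402.6270 p. 3, p. 15]: "one can prove for
some small real quadratic fields a Base Change theorem, all that is left is a finite computational check … work in
progress" / "an algorithm that given a totally real number field, checks whether our approach implies Base Change over
that field via a finite computation" (the announced [LuisAriel] never appeared: `lit search`, crossref, `lit citing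
arxiv:1402.6270` → 2 citing works, none on base change).  DECIDED SUB-CELLS of the rung in print (not the rung):
elliptic curves over real quadratic fields base-change to every totally real extension (Dieulefait–Freitas, C. R. Math.
353 (2015) Thms. 1–3 [corpus:paper:arxiv-1402.6232 p. 3]); CM `π₀` (automorphic induction); `F/F₀` solvable (Langlands,
Arthur–Clozel).

`floor → rung` does NOT close (BC2 probe P_C: `exact?` "could not close the goal", `aesop` unsolved goals; the
tribunal's forward kernel runs it again): the one move of F1 — bottom degree `1 → 2` — is real.
-/

noncomputable section

set_option linter.dupNamespace false

open scoped MatrixGroups Matrix NumberField Classical Polynomial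
open Filter IsDedekindDomain Field Polynomial NumberField
open Literature.NumberTheory.Automorphic Literature.NumberTheory.GaloisRepresentations
open Literature.NumberTheory.PAdicHodge
open Summit.Langlands

namespace Summit.Langlands.Langlands.Cruxes.ReciprocityUpToIrreducibility.RealQuadraticBaseChangeGL2


/-- **The RUNG FAMILY, dial = degree `d₀` of the totally real bottom field** (verbatim as in `_onpath` / `_special`):
non-solvable base change for `GL₂` from totally real fields `F₀` of degree `d₀` — for every cuspidal `π₀` of
`GL₂(𝔸_{F₀})` with a REGULAR `L`-algebraic infinity type, every `ι`, every framed `ρ₀` attached to `π₀` at almost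
all places and every totally real extension `F ⊇ F₀` (any `F₀`-algebra structure; no solvability): if `ρ₀|Γ_F` is
irreducible, a.e. unramified and de Rham above `ℓ` for Fontaine's pinned datum, it is automorphic (`IsAutomorphicAE`). -/
def NonsolvableBaseChangeGL2 (d₀ : ℕ) : Prop :=
  ∀ (F₀ : Type) [Field F₀] [NumberField F₀] [IsTotallyReal F₀], Module.finrank ℚ F₀ = d₀ →
    ∀ (hcpt₀ : isCompact_glFiniteIntegralLevel 2 F₀) (π₀ : CuspidalAutomorphicRepData 2 F₀ hcpt₀),
      (∃ T : InfinityType F₀ 2, π₀.1.HasInfinityType T ∧ T.IsRegular ∧ T.IsLAlgebraic) →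
      ∀ (ℓ : ℕ) [Fact ℓ.Prime] (ι : PadicAlgCl ℓ ≃+* ℂ) (ρ₀ : FramedGaloisRep F₀ (PadicAlgCl ℓ) 2),
        SatakeFrobCompatibleAE ι π₀.1 ρ₀ →
        ∀ (F : Type) [Field F] [NumberField F] [Algebra F₀ F] [IsTotallyReal F],
          (ρ₀.restrictField F).toGaloisRep.IsIrreducible →
          (∀ᶠ w : HeightOneSpectrum (𝓞 F) in cofinite, (ρ₀.restrictField F).IsUnramifiedAt w) →
          (∀ (w : HeightOneSpectrum (𝓞 F)) (hw : ((ℓ : ℕ) : 𝓞 F) ∈ w.asIdeal),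
              (fontainePstAdicCompletion w ℓ hw).IsDeRhamFramed ((ρ₀.restrictField F).toLocal w)) →
          ∀ (hcpt : isCompact_glFiniteIntegralLevel 2 F), IsAutomorphicAE ι hcpt (ρ₀.restrictField F)

/-- **THE RUNG (θ19 = 2)**: non-solvable base change for `GL₂` from REAL QUADRATIC bottom fields. -/
def RealQuadraticBaseChangeGL2 : Prop := NonsolvableBaseChangeGL2 2


/-! ## F3: the family at `d₀ = 1` is the floor (sorry-free) -/

/-- **`floor_one`**: Dieulefait 2015 Thm. 1.2 (in-tree named fact) ⇒ `NonsolvableBaseChangeGL2 1`. -/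
theorem floor_one (h : Dieulefait2015_baseChange_GL2) : NonsolvableBaseChangeGL2 1 := by
  intro F₀ _ _ _ hd hcpt₀ π₀ hreg ℓ _ ι ρ₀ hcomp F _ _ _ _ _hirr _hunr _hdR hcpt
  exact h F₀ hd hcpt₀ π₀ hreg ℓ ι ρ₀ hcomp F hcpt

/-- **THE F3 WITNESS LINE**: `example : Rung ⟨floor parameters⟩` from the floor decl, no sorry. -/
example (h : Dieulefait2015_baseChange_GL2) : NonsolvableBaseChangeGL2 1 := floor_one h

/-- Conversely the floor is EXACTLY the degree-one member with its three redundant hypotheses dropped: the degree-one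
member follows from the floor and nothing else is used (informational; the floor itself is not re-derived from the
member since the member asks irreducibility of `ρ₀|Γ_F`). -/
example : (Dieulefait2015_baseChange_GL2 → NonsolvableBaseChangeGL2 1) := floor_one

/-- The degree-zero member is vacuous (a number field has positive degree) — so the ladder starts at the floor. -/
theorem family_zero : NonsolvableBaseChangeGL2 0 := by
  intro F₀ _ _ _ hd
  exact absurd hd (Module.finrank_pos (R := ℚ) (M := F₀)).ne'

end Summit.Langlands.Langlands.Cruxes.ReciprocityUpToIrreducibility.RealQuadraticBaseChangeGL2

end
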